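import Summits.FinalStateConjecture.FinalStateConjecture.Theorems.EIHFluxBalanceModulatedKerrHandoffDragKernel
import Summits.FinalStateConjecture.FinalStateConjecture.Theorems.EIHFluxBalanceModulatedKerrHandoffDragSmooth

/-!
# Route EIHFluxBalance — `ModulatedKerrHandoff`, stub `stub_dragEstimates`: the pointwise drag estimate

Helper file for the crux `stmt-FinalStateConjecture-10167`
(`Summit.FinalStateConjecture.FinalStateConjecture.Theses.EIHFluxBalance.ModulatedKerrHandoff`),
line `overlap-modulation-second-iterate`, stub `stub_dragEstimates`; continuation of `…DragKernel`,
`…DragSmooth`.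

`drag_pointwise`: for ONE hole `(M, a)` with smooth moduli `(Λ, ξ)`, tame after `τ₀`, and an abstract
matrix path `t ↦ A(t)` of `C³` size `K_A/t` after `T_A`, the drag term
`y ↦ D[h_{moduli(y⁰)}](y)[A(y⁰)(y − c(y⁰))] + h(y)(A(y⁰)·, ·) + h(y)(·, A(y⁰)·)`
(`h = boostedKerrBilin (Λ(y⁰)) (c(y⁰)) M a · − η`, `c(t) = (t, ξ t)`) satisfies at every late lab point
`x` off the core (`r > r_in`)

  `‖Dᵐ(drag)(x)‖ ≤ K ε / x⁰`,  `m ≤ 3`,  `ε = (max (max 1 (2|a|)) ‖x̲ − ξ(x⁰)‖)⁻¹`.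

Mechanism (all at the point `x`, in the size format of `…OneHoleCalculus`): `h = ε • 𝔉 ∘ p` and
`Dh[V] = ε • D𝔉(p)[(0,0,0, ε S Λ⁻¹ V)]` for the kernel `𝔉` and the parameter map `p` of `…DragKernel`;
`p` has bounded positive-order size and `p(x)` lies in a compact kernel box whose scaled radius is
`≥ min (r_in/D₀) (1/2)` (`min_le_scale_mul_radius`: near the hole the scale is `1/D₀` and `r > r_in`,
far from it the scale is `1/d` and `r ≥ d/2` because boosts stretch spatial vectors), so `𝔉 ∘ p`,
`D𝔉 ∘ p` have bounded `C³` size (Faà di Bruno); the displacement `y − c(y⁰)` costs `max d (2 + A)`,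
absorbed by one factor `ε`; the matrix costs `K_A/x⁰`; Leibniz. Kerr–Schild 1965, §3; Dieudonné 1960,
(8.12). [folklore]
-/

noncomputable section

-- `Summit.<S>.<S>.…` (single-problem summit, D-0017) trips core's duplicate-namespace linter.
set_option linter.dupNamespace false

open Set Filter Function Literature.Geometry.Lorentzian
open scoped Topology ContDiff BigOperators

namespace Summit.FinalStateConjecture.FinalStateConjecture.Theorems

namespace Drag

open OneHole

/-! ### The scale and the box of the instantaneous parameter point -/

/-- **The scale reaches the core.** With `D₀ = max 1 (2|a|)`, `ε = (max D₀ d)⁻¹`, a rest-frame radius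
`r > r_in > 0` with `r² ≥ d² − a²` (slab point at lab distance `d` from the centre; boosts stretch spatial
vectors) satisfies `ε r ≥ min (r_in / D₀) (1/2)`: near the hole `ε = 1/D₀` and `r > r_in`; far from it
`ε = 1/d` and `r ≥ d/2`. [folklore] -/
theorem min_le_scale_mul_radius {a rin d r : ℝ} (hrin : 0 < rin) (hr : rin < r)
    (hr2 : d ^ 2 - a ^ 2 ≤ r ^ 2) :
    min (rin / max 1 (2 * |a|)) (1 / 2) ≤ (max (max 1 (2 * |a|)) d)⁻¹ * r := by
  have hr0 : 0 < r := hrin.trans hr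
  have hD₀ : 1 ≤ max 1 (2 * |a|) := le_max_left _ _
  rcases le_or_gt d (max 1 (2 * |a|)) with hle | hgt
  · rw [max_eq_left hle]
    refine (min_le_left _ _).trans ?_
    rw [div_eq_inv_mul]
    exact mul_le_mul_of_nonneg_left hr.le (inv_nonneg.mpr (by positivity))
  · rw [max_eq_right hgt.le]
    refine (min_le_right _ _).trans ?_
    have hd0 : 0 < d := (lt_of_lt_of_le one_pos hD₀).trans hgt
    have ha : 2 * |a| < d := (le_max_right _ _).trans_lt hgt
    have ha2 : a ^ 2 ≤ d ^ 2 / 4 := by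
      rw [← sq_abs a]; nlinarith [abs_nonneg a]
    have hrd : (d / 2) ^ 2 ≤ r ^ 2 := by nlinarith
    have hrd' := (sq_le_sq₀ (by positivity) hr0.le).mp hrd
    rw [le_inv_mul_iff₀ hd0]
    linarith

/-- The scale `ε = (max D₀ d)⁻¹`, `D₀ = max 1 (2|a|)`: `0 < ε ≤ 1`, `ε d ≤ 1`, `ε ≤ (max 1 d)⁻¹`. [folklore] -/
theorem scale_bounds (a d : ℝ) :
    0 < (max (max 1 (2 * |a|)) d)⁻¹ ∧ (max (max 1 (2 * |a|)) d)⁻¹ ≤ 1 ∧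
      (max (max 1 (2 * |a|)) d)⁻¹ * d ≤ 1 ∧ (max (max 1 (2 * |a|)) d)⁻¹ ≤ (max 1 d)⁻¹ := by
  have h1 : 1 ≤ max (max 1 (2 * |a|)) d := (le_max_left _ _).trans (le_max_left _ _)
  have h0 : 0 < max (max 1 (2 * |a|)) d := one_pos.trans_le h1
  refine ⟨inv_pos.mpr h0, inv_le_one_of_one_le₀ h1, ?_, ?_⟩
  · rw [inv_mul_le_iff₀ h0, mul_one]; exact le_max_right _ _
  · exact inv_anti₀ (lt_of_lt_of_le one_pos (le_max_left _ _))
      (max_le_max (le_max_left _ _) le_rfl)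

/-! ### The pointwise drag estimate for one hole -/

section Pointwise

variable {Λ : ℝ → lorentzGroup} {ξ : ℝ → E3} {Am : ℝ → E4 →L[ℝ] E4} {A Cθ KA TA τ₀ rin : ℝ}

/-- The instantaneous rest-frame radius `y ↦ r_a(Λ(y⁰)⁻¹(y − c(y⁰)))` is continuous (smooth moduli,
continuous Kerr–Schild radius), so it stays positive near a point off the ring. [folklore] -/
theorem eventually_radius_pos (a : ℝ) (hΛ : ContDiff ℝ ∞ (fun t ↦ ((Λ t : E4 ≃L[ℝ] E4) : E4 →L[ℝ] E4)))
    (hξ : ContDiff ℝ ∞ ξ) {x : E4}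
    (hx : 0 < Kerr.radius a (poincareInv (Λ (x 0)) (E4.ofTimeSpace (x 0) (ξ (x 0))) x)) :
    ∀ᶠ y in 𝓝 x, 0 < Kerr.radius a (poincareInv (Λ (y 0)) (E4.ofTimeSpace (y 0) (ξ (y 0))) y) := by
  have hA : ContDiff ℝ ∞ (fun y : E4 ↦ (((Λ (y 0) : E4 ≃L[ℝ] E4).symm : E4 ≃L[ℝ] E4) : E4 →L[ℝ] E4)) :=
    (contDiff_theta hΛ).comp contDiff_time
  have hP : Continuous (fun y : E4 ↦ poincareInv (Λ (y 0)) (E4.ofTimeSpace (y 0) (ξ (y 0))) y) := by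
    show Continuous (fun y : E4 ↦
      ((Λ (y 0) : E4 ≃L[ℝ] E4).symm) (y - E4.ofTimeSpace (y 0) (ξ (y 0))))
    exact (hA.clm_apply (contDiff_id.sub (contDiff_centreEvent hξ))).continuous
  exact ((Kerr.continuous_radius a).comp hP).continuousAt.eventually (lt_mem_nhds hx)

/-- **THE POINTWISE DRAG ESTIMATE (one hole, abstract drag matrix).** Let the hole `(M, a)` have smooth
moduli `(Λ, ξ)`, tame after `τ₀` (`‖Λ⁽ᵏ⁾(t)‖ ≤ A`, `k ≤ 4`; `‖ξ⁽ᵏ⁾(t)‖ ≤ A`, `1 ≤ k ≤ 4`), with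
`‖(Λ⁻¹)⁽ᵏ⁾‖ ≤ C_θ‖Λ⁽ᵏ⁾‖`, and let the matrix path `t ↦ A(t)` be `C³` of size `K_A / t` at every
`t ≥ T_A ≥ max τ₀ 1`. Then there is `K ≥ 0` such that at every lab point `x` with `x⁰ ≥ T_A` off the core
(`r > r_in > 0`) the drag term
`y ↦ D[h_{moduli(y⁰)}](y)[A(y⁰)(y − c(y⁰))] + h(y)(A(y⁰)·, ·) + h(y)(·, A(y⁰)·)` has
`‖Dᵐ(·)(x)‖ ≤ K ε / x⁰` for `m ≤ 3`, `ε = (max (max 1 (2|a|)) ‖x̲ − ξ(x⁰)‖)⁻¹`: the field and its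
frozen derivative are `ε`, `ε²` times kernel values of bounded `C³` size (Faà di Bruno through the
kernel box, `…DragKernel`), the displacement costs `ε⁻¹`, the matrix `1/x⁰`. Kerr–Schild 1965, §3.
[folklore] -/
theorem drag_pointwise (M a : ℝ) (hΛ : ContDiff ℝ ∞ (fun t ↦ ((Λ t : E4 ≃L[ℝ] E4) : E4 →L[ℝ] E4)))
    (hξ : ContDiff ℝ ∞ ξ) (hC0 : 0 ≤ Cθ)
    (hCθ : ∀ (k : ℕ) (u : ℝ),
      ‖iteratedDeriv k (fun t ↦ (((Λ t : E4 ≃L[ℝ] E4).symm : E4 ≃L[ℝ] E4) : E4 →L[ℝ] E4)) u‖ ≤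
        Cθ * ‖iteratedDeriv k (fun t ↦ ((Λ t : E4 ≃L[ℝ] E4) : E4 →L[ℝ] E4)) u‖)
    (htame : ∀ t, τ₀ ≤ t →
      (∀ k, k ≤ 4 → ‖iteratedDeriv k (fun s ↦ ((Λ s : E4 ≃L[ℝ] E4) : E4 →L[ℝ] E4)) t‖ ≤ A) ∧
        ∀ k, 1 ≤ k → k ≤ 4 → ‖iteratedDeriv k ξ t‖ ≤ A)
    (hKA : 0 ≤ KA) (hTA : τ₀ ≤ TA ∧ 1 ≤ TA)
    (hAm : ∀ t₀, TA ≤ t₀ → ContDiffAt ℝ 3 Am t₀ ∧ ∀ k ≤ 3, ‖iteratedFDeriv ℝ k Am t₀‖ ≤ KA / t₀)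
    (hrin : 0 < rin) :
    ∃ K : ℝ, 0 ≤ K ∧ ∀ x : E4, TA ≤ x 0 →
      rin < Kerr.radius a (poincareInv (Λ (x 0)) (E4.ofTimeSpace (x 0) (ξ (x 0))) x) →
      ∀ m ≤ 3, ‖iteratedFDeriv ℝ m (fun y ↦
        fderiv ℝ (fun z ↦ boostedKerrBilin (Λ (y 0)) (E4.ofTimeSpace (y 0) (ξ (y 0))) M a z
          - Minkowski.bilin) y ((Am (y 0)) (y - (E4.ofTimeSpace (y 0) (ξ (y 0))))) +
        (boostedKerrBilin (Λ (y 0)) (E4.ofTimeSpace (y 0) (ξ (y 0))) M a y - Minkowski.bilin).comp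
          (Am (y 0)) +
        (ContinuousLinearMap.precomp ℝ (Am (y 0))).comp
          (boostedKerrBilin (Λ (y 0)) (E4.ofTimeSpace (y 0) (ξ (y 0))) M a y - Minkowski.bilin)) x‖ ≤
        K * (max (max 1 (2 * |a|)) ‖E4.spatial x - ξ (x 0)‖)⁻¹ / x 0 := by
  -- the kernel box (constants only)
  have hrb : 0 < min (rin / max 1 (2 * |a|)) (1 / 2) := lt_min (by positivity) (by norm_num)
  obtain ⟨B, hB0, hB⟩ := exists_ck_kernel 4 |M| (Cθ * A) |a| (Cθ * A) hrb
  obtain ⟨hOpen, h𝔉on⟩ := contDiffOn_kernel (n := 4)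
  set 𝔉 : ℝ × ((E4 →L[ℝ] E4) × (ℝ × E3)) → E4 →L[ℝ] E4 →L[ℝ] ℝ := fun p ↦
    (Kerr.bilin p.1 p.2.2.1 (E4.ofTimeSpace 0 p.2.2.2) - Minkowski.bilin).bilinearComp p.2.1 p.2.1 with h𝔉
  have hA0 : 0 ≤ A := (norm_nonneg _).trans ((htame TA hTA.1).1 0 (Nat.zero_le _))
  have hflip : ‖(ContinuousLinearMap.compL ℝ E4 E4 ℝ).flip‖ ≤ 1 := by
    rw [ContinuousLinearMap.opNorm_flip]
    exact ContinuousLinearMap.norm_compL_le ℝ E4 E4 ℝ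
  refine ⟨8 * (6 * B * max 1 (max (Cθ * A) (8 * (Cθ * A) * max 1 (2 + A))) ^ 3) * (384 * (Cθ * A) * KA * (2 + A)) + 96 * (6 * B * max 1 (max (Cθ * A) (8 * (Cθ * A) * max 1 (2 + A))) ^ 3) * KA, by positivity, fun x hxT hxr m hm ↦ ?_⟩
  -- the point, the time, the scale
  have ht1 : 1 ≤ x 0 := hTA.2.trans hxT
  have ht0 : 0 < x 0 := one_pos.trans_le ht1
  have hτt : τ₀ ≤ x 0 := hTA.1.trans hxT
  obtain ⟨hAΛ, hAξ⟩ := htame (x 0) hτt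
  set d : ℝ := ‖E4.spatial x - ξ (x 0)‖ with hd
  have hd0 : 0 ≤ d := norm_nonneg _
  obtain ⟨hε0, hε1, hεd, -⟩ := scale_bounds a d
  set ε : ℝ := (max (max 1 (2 * |a|)) d)⁻¹ with hε
  -- sizes of the frame, the displacement and the parameter map at `x`
  have hθ := ck_theta_time hΛ hC0 hCθ hAΛ (n := 3) (by norm_num)
  obtain ⟨hW, hWval⟩ := ck_sub_centre hξ hAξ (n := 3) (by norm_num)
  have hεw : ε * d ≤ 1 := hεd
  have hq := ck₁_paramMap (Θ := fun y : E4 ↦ (((Λ (y 0) : E4 ≃L[ℝ] E4).symm : E4 ≃L[ℝ] E4) : E4 →L[ℝ] E4))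
    (W := fun y : E4 ↦ y - E4.ofTimeSpace (y 0) (ξ (y 0))) (x := x) M (ε * a) hθ hW hWval.le
    (by positivity) hε0.le hε1 hεw
  -- the parameter point lies in the box
  have hθ0 : ‖(((Λ (x 0) : E4 ≃L[ℝ] E4).symm : E4 ≃L[ℝ] E4) : E4 →L[ℝ] E4)‖ ≤ Cθ * A := by
    have h := hθ.2 0 (Nat.zero_le _)
    rwa [norm_iteratedFDeriv_zero] at h
  have hr2 := sq_sub_sq_le_radius_poincareInv_sq (Λ (x 0)) a (x 0) (ξ (x 0)) (x := x) rfl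
  have hrad : min (rin / max 1 (2 * |a|)) (1 / 2) ≤ Kerr.radius (ε * a) (E4.ofTimeSpace 0
      (ε • E4.spatial ((((Λ (x 0) : E4 ≃L[ℝ] E4).symm : E4 ≃L[ℝ] E4) : E4 →L[ℝ] E4)
        (x - E4.ofTimeSpace (x 0) (ξ (x 0)))))) := by
    rw [radius_scaledPosition hε0]
    exact min_le_scale_mul_radius hrin hxr hr2
  have hBq := hB (M, ((((Λ (x 0) : E4 ≃L[ℝ] E4).symm : E4 ≃L[ℝ] E4) : E4 →L[ℝ] E4),
      (ε * a, ε • E4.spatial ((((Λ (x 0) : E4 ≃L[ℝ] E4).symm : E4 ≃L[ℝ] E4) : E4 →L[ℝ] E4)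
        (x - E4.ofTimeSpace (x 0) (ξ (x 0))))))) le_rfl hθ0
    (by rw [abs_mul, abs_of_pos hε0]; exact mul_le_of_le_one_left (abs_nonneg a) hε1)
    (norm_scaledPosition_le hθ0 hWval.le hε0.le hεw) hrad
  -- the field and its frozen derivative through the kernel
  have hF := ck_kernel_comp (𝔉 := 𝔉) (x := x)
    (p := fun y : E4 ↦ ((M, ((((Λ (y 0) : E4 ≃L[ℝ] E4).symm : E4 ≃L[ℝ] E4) : E4 →L[ℝ] E4),
      (ε * a, ε • E4.spatial ((((Λ (y 0) : E4 ≃L[ℝ] E4).symm : E4 ≃L[ℝ] E4) : E4 →L[ℝ] E4)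
        (y - E4.ofTimeSpace (y 0) (ξ (y 0))))))) : ℝ × ((E4 →L[ℝ] E4) × (ℝ × E3)))) hBq hq
  have hF' := ck_fderiv_kernel_comp (𝔉 := 𝔉) (x := x)
    (p := fun y : E4 ↦ ((M, ((((Λ (y 0) : E4 ≃L[ℝ] E4).symm : E4 ≃L[ℝ] E4) : E4 →L[ℝ] E4),
      (ε * a, ε • E4.spatial ((((Λ (y 0) : E4 ≃L[ℝ] E4).symm : E4 ≃L[ℝ] E4) : E4 →L[ℝ] E4)
        (y - E4.ofTimeSpace (y 0) (ξ (y 0))))))) : ℝ × ((E4 →L[ℝ] E4) × (ℝ × E3)))) hBq hq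
  have hh := ck_const_smul hF ε
  have hidh : (fun y : E4 ↦ boostedKerrBilin (Λ (y 0)) (E4.ofTimeSpace (y 0) (ξ (y 0))) M a y
      - Minkowski.bilin) = fun y ↦ ε • 𝔉 ((M, ((((Λ (y 0) : E4 ≃L[ℝ] E4).symm : E4 ≃L[ℝ] E4) : E4 →L[ℝ] E4),
        (ε * a, ε • E4.spatial ((((Λ (y 0) : E4 ≃L[ℝ] E4).symm : E4 ≃L[ℝ] E4) : E4 →L[ℝ] E4)
          (y - E4.ofTimeSpace (y 0) (ξ (y 0))))))) : ℝ × ((E4 →L[ℝ] E4) × (ℝ × E3))) :=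
    funext fun y ↦ boostedKerrBilin_sub_eq_smul_kernel (Λ (y 0)) _ M a hε0 y
  rw [← hidh] at hh
  -- the matrix read at lab time
  have hπ : ContDiffAt ℝ 3 (fun y : E4 ↦ y 0) x ∧
      ∀ i, 1 ≤ i → i ≤ 3 → ‖iteratedFDeriv ℝ i (fun y : E4 ↦ y 0) x‖ ≤ 1 :=
    ck₁_mono (ck₁_clm 3 (EuclideanSpace.proj (0 : Fin 4) : E4 →L[ℝ] ℝ) x) le_rfl norm_dt_le
  have hAmx := ck_comp (g := Am) (f := fun y : E4 ↦ y 0) (x := x) (hAm (x 0) hxT) hπ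
  rw [max_self, one_pow, mul_one, show (Nat.factorial 3 : ℝ) = 6 by norm_num] at hAmx
  -- T2
  have hT2 := ck_clm_comp hh hAmx
  -- T3
  have hP := ck_clm_comp_left (G := (E4 →L[ℝ] ℝ) →L[ℝ] (E4 →L[ℝ] ℝ)) hAmx
    ((ContinuousLinearMap.compL ℝ E4 E4 ℝ).flip)
  have hP' := ck_mono hP le_rfl (show ‖(ContinuousLinearMap.compL ℝ E4 E4 ℝ).flip‖ * (6 * (KA / x 0))
      ≤ 1 * (6 * (KA / x 0)) from mul_le_mul_of_nonneg_right hflip (by positivity))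
  have hT3' := ck_clm_comp hP' hh
  have hT3eq : (fun y : E4 ↦ ((ContinuousLinearMap.compL ℝ E4 E4 ℝ).flip (Am (y 0))).comp
      (boostedKerrBilin (Λ (y 0)) (E4.ofTimeSpace (y 0) (ξ (y 0))) M a y - Minkowski.bilin)) =
      fun y ↦ (ContinuousLinearMap.precomp ℝ (Am (y 0))).comp
        (boostedKerrBilin (Λ (y 0)) (E4.ofTimeSpace (y 0) (ξ (y 0))) M a y - Minkowski.bilin) :=
    funext fun y ↦ by rw [precomp_eq_compL_flip]
  rw [hT3eq] at hT3'
  -- T1: the vector fed to the frozen derivative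
  have hV := ck_clm_apply hAmx (ck_of_ck₁ hW hWval.le)
  have hθV := ck_clm_apply hθ hV
  have hlast := ck_const_smul (ck_clm_comp_left hθV (E4.spatial : E4 →L[ℝ] E3)) ε
  have hlast' : ContDiffAt ℝ 3 (fun y : E4 ↦ ε • E4.spatial ((((Λ (y 0) : E4 ≃L[ℝ] E4).symm :
      E4 ≃L[ℝ] E4) : E4 →L[ℝ] E4) ((Am (y 0)) (y - E4.ofTimeSpace (y 0) (ξ (y 0)))))) x ∧
      ∀ i ≤ 3, ‖iteratedFDeriv ℝ i (fun y : E4 ↦ ε • E4.spatial ((((Λ (y 0) : E4 ≃L[ℝ] E4).symm :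
        E4 ≃L[ℝ] E4) : E4 →L[ℝ] E4) ((Am (y 0)) (y - E4.ofTimeSpace (y 0) (ξ (y 0)))))) x‖ ≤ (384 * (Cθ * A) * KA * (2 + A)) / x 0 := by
    refine ck_mono hlast le_rfl ?_
    rw [abs_of_pos hε0]
    have hm : ε * max d (2 + A) ≤ 2 + A := by
      rcases le_total d (2 + A) with h | h
      · rw [max_eq_right h]; exact mul_le_of_le_one_left (by positivity) hε1
      · rw [max_eq_left h]; exact hεw.trans (by linarith)
    have hS := norm_spatial_le
    have e1 : ε * (‖(E4.spatial : E4 →L[ℝ] E3)‖ * (2 ^ 3 * (Cθ * A) * (2 ^ 3 * (6 * (KA / x 0)) *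
        max ‖E4.spatial x - ξ (x 0)‖ (2 + A)))) =
        ‖(E4.spatial : E4 →L[ℝ] E3)‖ * ((384 * (Cθ * A) * KA / x 0) * (ε * max d (2 + A))) := by
      rw [hd]; ring
    rw [e1]
    have h0 : 0 ≤ 384 * (Cθ * A) * KA / x 0 := by positivity
    calc ‖(E4.spatial : E4 →L[ℝ] E3)‖ * ((384 * (Cθ * A) * KA / x 0) * (ε * max d (2 + A)))
        ≤ 1 * ((384 * (Cθ * A) * KA / x 0) * (2 + A)) :=
          mul_le_mul hS (mul_le_mul_of_nonneg_left hm h0) (by positivity) zero_le_one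
      _ = 384 * (Cθ * A) * KA * (2 + A) / x 0 := by ring
  have hg := ck_prodMk (ck_const 3 (0 : ℝ) x) (ck_prodMk (ck_const 3 (0 : E4 →L[ℝ] E4) x)
    (ck_prodMk (ck_const 3 (0 : ℝ) x) hlast'))
  have hg' := ck_mono hg le_rfl (show max ‖(0 : ℝ)‖ (max ‖(0 : E4 →L[ℝ] E4)‖ (max ‖(0 : ℝ)‖
      ((384 * (Cθ * A) * KA * (2 + A)) / x 0))) ≤ (384 * (Cθ * A) * KA * (2 + A)) / x 0 by
    rw [norm_zero, norm_zero]
    have : 0 ≤ (384 * (Cθ * A) * KA * (2 + A)) / x 0 := by positivity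
    simp [this])
  have hT1' := ck_const_smul (ck_clm_apply hF' hg') ε
  -- T1: the identity with the frozen derivative, near `x`
  have hev := eventually_radius_pos a hΛ hξ (hrin.trans hxr)
  have hT1eq : (fun y : E4 ↦ ε • (fderiv ℝ 𝔉 ((M, ((((Λ (y 0) : E4 ≃L[ℝ] E4).symm : E4 ≃L[ℝ] E4) :
      E4 →L[ℝ] E4), (ε * a, ε • E4.spatial ((((Λ (y 0) : E4 ≃L[ℝ] E4).symm : E4 ≃L[ℝ] E4) : E4 →L[ℝ] E4)
        (y - E4.ofTimeSpace (y 0) (ξ (y 0))))))) : ℝ × ((E4 →L[ℝ] E4) × (ℝ × E3))))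
      (((0 : ℝ), ((0 : E4 →L[ℝ] E4), ((0 : ℝ), ε • E4.spatial ((((Λ (y 0) : E4 ≃L[ℝ] E4).symm :
        E4 ≃L[ℝ] E4) : E4 →L[ℝ] E4) ((Am (y 0)) (y - E4.ofTimeSpace (y 0) (ξ (y 0)))))))))) =ᶠ[𝓝 x]
      fun y ↦ fderiv ℝ (fun z ↦ boostedKerrBilin (Λ (y 0)) (E4.ofTimeSpace (y 0) (ξ (y 0))) M a z
        - Minkowski.bilin) y ((Am (y 0)) (y - (E4.ofTimeSpace (y 0) (ξ (y 0))))) := by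
    filter_upwards [hev] with y hy
    have hqy : 0 < Kerr.radius (ε * a) (E4.ofTimeSpace 0 (ε • E4.spatial
        ((Λ (y 0) : E4 ≃L[ℝ] E4).symm (y - E4.ofTimeSpace (y 0) (ξ (y 0)))))) := by
      rw [radius_scaledPosition hε0]
      exact mul_pos hε0 hy
    have hd4 : ContDiffAt ℝ 4 𝔉 (M, ((((Λ (y 0) : E4 ≃L[ℝ] E4).symm : E4 ≃L[ℝ] E4) : E4 →L[ℝ] E4),
        (ε * a, ε • E4.spatial ((Λ (y 0) : E4 ≃L[ℝ] E4).symm (y - E4.ofTimeSpace (y 0) (ξ (y 0))))))) :=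
      h𝔉on.contDiffAt (hOpen.mem_nhds hqy)
    exact (fderiv_boostedKsPert_apply (Λ (y 0)) (E4.ofTimeSpace (y 0) (ξ (y 0))) M a hε0 y
      ((Am (y 0)) (y - E4.ofTimeSpace (y 0) (ξ (y 0)))) hd4).symm
  have hT1 := ck_congr hT1' hT1eq
  -- the sum
  have hsum := ck_add (ck_add hT1 hT2) hT3'
  refine (hsum.2 m hm).trans (le_of_eq ?_)
  rw [abs_of_pos hε0]
  ring

end Pointwise

end Drag

/-- Registered sub-goal form (stub `drag_min_le_scale_mul_radius` of the crux item) of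
`Drag.min_le_scale_mul_radius`: the scale `(max D₀ d)⁻¹`, `D₀ = max 1 (2|a|)`, times a rest-frame
radius `r > r_in` with `r² ≥ d² − a²` is at least `min (r_in/D₀) (1/2)`. [folklore] -/
theorem drag_min_le_scale_mul_radius : ∀ {a rin d r : ℝ}, 0 < rin → rin < r → d ^ 2 - a ^ 2 ≤ r ^ 2 → min (rin / max 1 (2 * |a|)) (1 / 2) ≤ (max (max 1 (2 * |a|)) d)⁻¹ * r :=
  fun hrin hr hr2 ↦ Drag.min_le_scale_mul_radius hrin hr hr2

end Summit.FinalStateConjecture.FinalStateConjecture.Theorems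

end
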